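import Summits.AnomalousDissipation.AnomalousDissipation.Theorems.WazewskiBlockSubLaminarObliqueBlocks

/-!
# Route `WazewskiBlock`, item stmt-AnomalousDissipation-10354 — chain parametrisations of the blocks and block triangularity of `linMatrix`

The chains `(j, 2T-2i, j)` and `(0, 2(N/2 - i), 0)`, the block labels, and the block-triangular
structure of `linMatrix` with respect to `blockLabel`. All statements proved; no definitions.
-/

noncomputable section

set_option linter.dupNamespace false

open scoped InnerProductSpace ComplexConjugate
open Finset
open Literature.Analysis.FunctionSpaces Literature.Analysis.FunctionSpaces.Torus
open Literature.Analysis.FluidPDE Literature.Analysis.FluidPDE.Torus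

namespace Summit.AnomalousDissipation.AnomalousDissipation.Theorems.Oblique
/-! ### Parametrising the blocks by chains -/

/-- The half-length `T` of the chain with first coordinate `j`: `2j² + 4t² ≤ N² ↔ t ≤ T`. [folklore] -/
theorem exists_chain_halfLength (N j : ℕ) (hjN : 2 * j ^ 2 ≤ N ^ 2) :
    ∃ T : ℕ, ∀ t : ℕ, 2 * j ^ 2 + 4 * t ^ 2 ≤ N ^ 2 ↔ t ≤ T := by
  refine ⟨Nat.sqrt ((N ^ 2 - 2 * j ^ 2) / 4), fun t => ?_⟩
  rw [Nat.le_sqrt, Nat.le_div_iff_mul_le (by norm_num)]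
  constructor <;> intro h
  · have : t * t * 4 = 4 * t ^ 2 := by ring
    omega
  · have : t * t * 4 = 4 * t ^ 2 := by ring
    omega

/-- **The chain modes** `(j, 2T - 2i, j)`, `i ≤ 2T`, are representatives (`j ≥ 1`). [folklore] -/
theorem chainMode_mem {N j T : ℕ} (hj : 1 ≤ j) (hT : ∀ t : ℕ, 2 * j ^ 2 + 4 * t ^ 2 ≤ N ^ 2 ↔ t ≤ T)
    (i : Fin (2 * T + 1)) : (![(j : ℤ), 2 * (T : ℤ) - 2 * (i : ℤ), (j : ℤ)] : Fin 3 → ℤ) ∈ obliqueReps N := by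
  have hi : (i : ℕ) ≤ 2 * T := Nat.lt_succ_iff.1 i.2
  refine mem_obliqueReps.2 ⟨mem_obliqueModes.2 ⟨?_, ?_, by simp, ?_⟩, Or.inl (by simp; omega)⟩
  · rw [mem_freqBall]
    simp only [freqNormSq, Fin.sum_univ_three, Matrix.cons_val_zero, Matrix.cons_val_one, Matrix.head_cons,
      Matrix.cons_val_two, Matrix.tail_cons]
    -- `|2T - 2i| ≤ 2T`
    have hTT := (hT T).2 le_rfl
    have hcast : (2 * (j : ℝ) ^ 2 + 4 * (T : ℝ) ^ 2) ≤ (N : ℝ) ^ 2 := by exact_mod_cast hTT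
    have hb : ((2 * (T : ℤ) - 2 * (i : ℤ) : ℤ) : ℝ) ^ 2 ≤ 4 * (T : ℝ) ^ 2 := by
      have h1 : (0 : ℝ) ≤ (i : ℕ) := Nat.cast_nonneg _
      have h2 : ((i : ℕ) : ℝ) ≤ 2 * T := by exact_mod_cast hi
      push_cast
      nlinarith
    push_cast at hb ⊢
    nlinarith
  · intro h
    have := congrFun h 0
    simp at this
    omega
  · simp only [Matrix.cons_val_one, Matrix.cons_val_zero]
    exact ⟨(T : ℤ) - (i : ℤ), by ring⟩

/-- Every representative with first coordinate `j ≥ 1` is a chain mode. [folklore] -/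
theorem exists_eq_chainMode {N j T : ℕ} (hT : ∀ t : ℕ, 2 * j ^ 2 + 4 * t ^ 2 ≤ N ^ 2 ↔ t ≤ T)
    {k : Fin 3 → ℤ} (hk : k ∈ obliqueReps N) (h0 : k 0 = j) :
    ∃ i : Fin (2 * T + 1), k = ![(j : ℤ), 2 * (T : ℤ) - 2 * (i : ℤ), (j : ℤ)] := by
  obtain ⟨hkm, _⟩ := mem_obliqueReps.1 hk
  obtain ⟨hball, _, h02, ⟨r, hr⟩⟩ := mem_obliqueModes.1 hkm
  -- `|r| ≤ T`
  have hq := mem_freqBall.1 hball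
  rw [freqNormSq_eq_of_mem hkm, h0, hr] at hq
  have hrT : r.natAbs ≤ T := by
    rw [← hT]
    have h1 : ((2 * j ^ 2 + 4 * r.natAbs ^ 2 : ℕ) : ℝ) ≤ (N : ℝ) ^ 2 := by
      push_cast
      have : ((r.natAbs : ℕ) : ℝ) ^ 2 = (r : ℝ) ^ 2 := by
        rw [Nat.cast_natAbs, Int.cast_abs, sq_abs]
      rw [this]
      have h4 : (((r + r : ℤ)) : ℝ) ^ 2 = 4 * (r : ℝ) ^ 2 := by push_cast; ring
      have hq' : 2 * ((j : ℕ) : ℝ) ^ 2 + (((r + r : ℤ)) : ℝ) ^ 2 ≤ (N : ℝ) ^ 2 := by exact_mod_cast hq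
      rw [h4] at hq'
      exact hq'
    exact_mod_cast h1
  have hlt : ((T : ℤ) - r).toNat < 2 * T + 1 := by
    have h1 : (T : ℤ) - r ≤ 2 * T := by omega
    omega
  have hnn : (0 : ℤ) ≤ (T : ℤ) - r := by omega
  have hval : (((⟨((T : ℤ) - r).toNat, hlt⟩ : Fin (2 * T + 1)) : ℕ) : ℤ) = (T : ℤ) - r := by
    simp [Int.toNat_of_nonneg hnn]
  refine ⟨⟨((T : ℤ) - r).toNat, hlt⟩, ?_⟩
  funext m
  fin_cases m
  · simpa using h0
  · simp only [Matrix.cons_val_one, Matrix.cons_val_zero, Fin.mk_one, hval]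
    rw [hr]; ring
  · simp only [Matrix.cons_val_two, Matrix.tail_cons, Matrix.head_cons, Fin.reduceFinMk]
    rw [← h02, h0]

/-- **The gravest (`j = 0`) modes** `(0, 2(T₀ - i), 0)`, `i < T₀ = N/2`, are representatives. [folklore] -/
theorem axisMode_mem {N : ℕ} (i : Fin (N / 2)) :
    (![(0 : ℤ), 2 * ((N / 2 : ℕ) : ℤ) - 2 * (i : ℤ), 0] : Fin 3 → ℤ) ∈ obliqueReps N := by
  have hi : (i : ℕ) < N / 2 := i.2
  have hN2 : 2 * (N / 2) ≤ N := Nat.mul_div_le N 2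
  refine mem_obliqueReps.2 ⟨mem_obliqueModes.2 ⟨?_, ?_, by simp, ?_⟩, Or.inr ⟨by simp, by simp; omega⟩⟩
  · rw [mem_freqBall]
    simp only [freqNormSq, Fin.sum_univ_three, Matrix.cons_val_zero, Matrix.cons_val_one, Matrix.head_cons,
      Matrix.cons_val_two, Matrix.tail_cons]
    have h2 : ((2 * ((N / 2 : ℕ) : ℤ) - 2 * (i : ℤ) : ℤ) : ℝ) ^ 2 ≤ (N : ℝ) ^ 2 := by
      have h1 : (0 : ℝ) ≤ (i : ℕ) := Nat.cast_nonneg _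
      have h2 : ((i : ℕ) : ℝ) < (N / 2 : ℕ) := by exact_mod_cast hi
      have h3 : (2 * ((N / 2 : ℕ) : ℝ)) ≤ N := by exact_mod_cast hN2
      have h4 : (0 : ℝ) ≤ 2 * ((N / 2 : ℕ) : ℝ) - 2 * ((i : ℕ) : ℝ) := by linarith
      have h5 : 2 * ((N / 2 : ℕ) : ℝ) - 2 * ((i : ℕ) : ℝ) ≤ N := by linarith
      push_cast
      calc (2 * ((N / 2 : ℕ) : ℝ) - 2 * ((i : ℕ) : ℝ)) ^ 2 ≤ (N : ℝ) ^ 2 := pow_le_pow_left₀ h4 h5 2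
        _ = _ := rfl
    push_cast at h2 ⊢
    nlinarith
  · intro h
    have := congrFun h 1
    simp at this
    omega
  · simp only [Matrix.cons_val_one, Matrix.cons_val_zero]
    exact ⟨((N / 2 : ℕ) : ℤ) - (i : ℤ), by ring⟩

/-- Every representative with first coordinate `0` is a gravest mode. [folklore] -/
theorem exists_eq_axisMode {N : ℕ} {k : Fin 3 → ℤ} (hk : k ∈ obliqueReps N) (h0 : k 0 = 0) :
    ∃ i : Fin (N / 2), k = ![(0 : ℤ), 2 * ((N / 2 : ℕ) : ℤ) - 2 * (i : ℤ), 0] := by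
  obtain ⟨hkm, hrep⟩ := mem_obliqueReps.1 hk
  obtain ⟨hball, _, h02, ⟨r, hr⟩⟩ := mem_obliqueModes.1 hkm
  have hk1 : 0 < k 1 := by
    rcases hrep with h | ⟨_, h⟩
    · omega
    · exact h
  have hq := mem_freqBall.1 hball
  rw [freqNormSq_eq_of_mem hkm, h0, hr] at hq
  have hr0 : 0 < r := by omega
  have hrN : 2 * r.toNat ≤ N := by
    have h1 : ((4 * r.toNat ^ 2 : ℕ) : ℝ) ≤ (N : ℝ) ^ 2 := by
      push_cast
      have : ((r.toNat : ℕ) : ℝ) = (r : ℝ) := by exact_mod_cast Int.toNat_of_nonneg hr0.le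
      rw [this]
      have h4 : (((r + r : ℤ)) : ℝ) ^ 2 = 4 * (r : ℝ) ^ 2 := by push_cast; ring
      have hq' : 2 * ((0 : ℕ) : ℝ) ^ 2 + (((r + r : ℤ)) : ℝ) ^ 2 ≤ (N : ℝ) ^ 2 := by exact_mod_cast hq
      rw [h4] at hq'
      simpa using hq'
    have h2 : 4 * r.toNat ^ 2 ≤ N ^ 2 := by exact_mod_cast h1
    nlinarith
  have hrle : r.toNat ≤ N / 2 := by omega
  refine ⟨⟨N / 2 - r.toNat, by omega⟩, ?_⟩
  have hval : (((⟨N / 2 - r.toNat, by omega⟩ : Fin (N / 2)) : ℕ) : ℤ) = ((N / 2 : ℕ) : ℤ) - r := by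
    rw [Fin.val_mk, Nat.cast_sub hrle, Int.toNat_of_nonneg hr0.le]
  funext m
  fin_cases m
  · simpa using h0
  · simp only [Matrix.cons_val_one, Matrix.cons_val_zero, Fin.mk_one, hval]
    rw [hr]; ring
  · simp only [Matrix.cons_val_two, Matrix.tail_cons, Matrix.head_cons, Fin.reduceFinMk]
    rw [← h02, h0]

/-- Decoding the block label: equal labels means equal polarisation and equal `k₀`. [folklore] -/
theorem blockLabel_eq_iff {N : ℕ} (p q : ObliqueIndex N) :
    blockLabel N p = blockLabel N q ↔ p.2 = q.2 ∧ (p.1 : Fin 3 → ℤ) 0 = (q.1 : Fin 3 → ℤ) 0 := by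
  have hq0 := fst_nonneg_of_mem_obliqueReps q.1.2
  have hp0 := fst_nonneg_of_mem_obliqueReps p.1.2
  have hqN := fst_le_of_mem_obliqueReps q.1.2
  have hpN := fst_le_of_mem_obliqueReps p.1.2
  have hσq : q.2 = 0 ∨ q.2 = 1 := by obtain ⟨_, σ⟩ := q; fin_cases σ <;> simp
  have hσp : p.2 = 0 ∨ p.2 = 1 := by obtain ⟨_, σ⟩ := p; fin_cases σ <;> simp
  simp only [blockLabel]
  rcases hσq with hq | hq <;> rcases hσp with hp | hp <;>
    simp only [hq, hp, if_true, Fin.isValue, one_ne_zero, zero_ne_one, if_false, zero_add, true_and, false_and,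
      iff_false] <;> omega

/-! ### Block triangularity of `linMatrix` -/

/-- For a perpendicular column `q = (k', 1)`, `repField q k` is a multiple of `perpVec`. [folklore] -/
theorem repField_perp {N : ℕ} (k' : ↥(obliqueReps N)) (k : Fin 3 → ℤ) :
    ∃ c : ℝ, repField ((k', (1 : Fin 2)) : ObliqueIndex N) k = c • perpVec := by
  by_cases h1 : k = (k' : Fin 3 → ℤ)
  · exact ⟨1, by simp [repField, h1, basisVec]⟩
  · by_cases h2 : k = -(k' : Fin 3 → ℤ)
    · refine ⟨-1, ?_⟩
      have h1' : ¬ (-(k' : Fin 3 → ℤ) = (k' : Fin 3 → ℤ)) := fun h => h1 (h2.trans h)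
      simp [repField, h2, h1', basisVec]
    · exact ⟨0, by simp [repField, h1, h2]⟩

/-- Unfolding of the block label comparison: `blockLabel q < blockLabel p` forces either a
perpendicular column against an in-plane row, or equal polarisations with `q₀ < p₀`. [folklore] -/
theorem blockLabel_lt_cases {N : ℕ} {p q : ObliqueIndex N} (h : blockLabel N q < blockLabel N p) :
    (q.2 = 1 ∧ p.2 = 0) ∨ (q.2 = p.2 ∧ (q.1 : Fin 3 → ℤ) 0 < (p.1 : Fin 3 → ℤ) 0) := by
  have hq0 := fst_nonneg_of_mem_obliqueReps q.1.2
  have hp0 := fst_nonneg_of_mem_obliqueReps p.1.2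
  have hqN := fst_le_of_mem_obliqueReps q.1.2
  have hpN := fst_le_of_mem_obliqueReps p.1.2
  have hqt : (((q.1 : Fin 3 → ℤ) 0).toNat : ℤ) = (q.1 : Fin 3 → ℤ) 0 := Int.toNat_of_nonneg hq0
  have hpt : (((p.1 : Fin 3 → ℤ) 0).toNat : ℤ) = (p.1 : Fin 3 → ℤ) 0 := Int.toNat_of_nonneg hp0
  simp only [blockLabel] at h
  have hσq : q.2 = 0 ∨ q.2 = 1 := by obtain ⟨_, σ⟩ := q; fin_cases σ <;> simp
  have hσp : p.2 = 0 ∨ p.2 = 1 := by obtain ⟨_, σ⟩ := p; fin_cases σ <;> simp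
  rcases hσq with hq | hq <;> rcases hσp with hp | hp
  · simp only [hq, hp, if_true] at h
    right; exact ⟨by rw [hq, hp], by omega⟩
  · simp only [hq, hp, if_true, Fin.isValue, one_ne_zero, if_false, zero_add] at h
    omega
  · left; exact ⟨hq, hp⟩
  · simp only [hq, hp, Fin.isValue, one_ne_zero, if_false, zero_add] at h
    right; exact ⟨by rw [hq, hp], by omega⟩

/-- **`linMatrix` is block triangular for `blockLabel`** (in-plane rows get nothing from
perpendicular columns; different `k₀` never couple). [folklore] -/
theorem blockTriangular_linMatrix (ν F : ℝ) (N : ℕ) : (linMatrix ν F N).BlockTriangular (blockLabel N) := by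
  intro p q hlt
  have hne : p ≠ q := fun h => by rw [h] at hlt; exact lt_irrefl _ hlt
  simp only [linMatrix, Matrix.of_apply, if_neg hne, zero_add]
  rcases blockLabel_lt_cases hlt with ⟨hq, hp⟩ | ⟨hσ, h0⟩
  · -- perpendicular column, in-plane row
    obtain ⟨k', σ'⟩ := q
    simp only at hq
    subst hq
    obtain ⟨c1, hc1⟩ := repField_perp k' ((p.1 : Fin 3 → ℤ) - modeE)
    obtain ⟨c2, hc2⟩ := repField_perp k' ((p.1 : Fin 3 → ℤ) + modeE)
    rw [hc1, hc2, hp, ← sub_smul, real_inner_smul_right]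
    have hin : ⟪basisVec (p.1 : Fin 3 → ℤ) 0, perpVec⟫_ℝ = 0 := by simpa [basisVec] using inner_inVec_perpVec (p.1 : Fin 3 → ℤ)
    rw [hin]
    simp [perpVec_apply_one]
  · -- same polarisation, `q₀ < p₀`: the shifted row mode is never `±` the column mode
    have hq0 := fst_nonneg_of_mem_obliqueReps q.1.2
    have h1 : ∀ s : ℤ, (p.1 : Fin 3 → ℤ) + s • modeE ≠ (q.1 : Fin 3 → ℤ) := fun s h => by
      have := congrFun h 0; simp [modeE_apply_zero] at this; omega
    have h2 : ∀ s : ℤ, (p.1 : Fin 3 → ℤ) + s • modeE ≠ -(q.1 : Fin 3 → ℤ) := fun s h => by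
      have := congrFun h 0; simp [modeE_apply_zero] at this; omega
    have hm : (p.1 : Fin 3 → ℤ) - modeE = (p.1 : Fin 3 → ℤ) + (-1 : ℤ) • modeE := by simp [sub_eq_add_neg]
    have hp' : (p.1 : Fin 3 → ℤ) + modeE = (p.1 : Fin 3 → ℤ) + (1 : ℤ) • modeE := by simp
    rw [hm, hp', repField_eq_zero q (h1 _) (h2 _), repField_eq_zero q (h1 _) (h2 _)]
    simp

end Summit.AnomalousDissipation.AnomalousDissipation.Theorems.Oblique

end
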